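import Mathlib
import HarnessLib
import Summits.Ventures.LatticeQCDFlow.Scaling.WilsonIdentityFlowLaw
import Summits.Ventures.LatticeQCDFlow.Scoring.SU2TorusPartitionFunction
import Summits.Ventures.LatticeQCDFlow.Scoring.U1TorusPartitionFunctionBessel

/-!
# LatticeQCDFlow / Scaling — the untrained exact sampler on the 2-d torus in Bessel closed form:
# SU(2): `ESS = (2/β)^{L²}·(Σ_{n≥1} I_n(2β)^{L²})²/Σ_{n≥1} I_n(4β)^{L²}`,
# `acc ≤ (4/β)^{L²}·(Σ_{n≥1} I_n(β)^{L²})²/Σ_{n≥1} I_n(2β)^{L²}`;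
# U(1): `ESS = (Σₖ I_{|k|}(β)^{L²})²/Σₖ I_{|k|}(2β)^{L²}` (theory-2's Haar measure)

HONEST FRAMING: exact (Metropolis-corrected) sampling algorithms for lattice gauge theory;
figures of merit are autocorrelation/cost numbers at stated couplings and volumes; no
continuum-physics claim.

Venture `LatticeQCDFlow` (cell pub-lqcd), topic `Scaling`; FANOUT row 3 (`s0-u1-a`, S0-B
implementation A, GEN-13).  NEW WORK of the cell (closed forms, no numerics): row 3's group-independent
identity-flow law `Scaling/WilsonIdentityFlowLaw` (imported: `ESS = Z(β)²/Z(2β)`,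
`(8/9)·Z(β)²/Z(2β) ≤ acc ≤ Z(β/2)²/Z(β)` on theory-2's product Haar measure) combined with row 5's
exact two-dimensional partition functions — `Scoring/SU2TorusPartitionFunction`
(`Z^{SU(2)}_{(ℤ/L)²}(β) = (e^{−2β}/β)^{L²} Σ_{n∈ℕ} I_{n+1}(2β)^{L²}`, `β > 0`, every `L ≥ 1`) and
`Scoring/U1TorusPartitionFunctionBessel` (`Z^{U(1)}_{(ℤ/L)²}(β) = e^{−βL²} Σ_{k∈ℤ} I_{|k|}(β)^{L²}`,
`L ≥ 2`), both imported:

* §1 SU(2) (`β > 0`, `V = L²`): **`su2TorusIdentityFlow_essFrac`**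
  `ESS = (2/β)^V (Σ_n I_{n+1}(2β)^V)² / Σ_n I_{n+1}(4β)^V` and **`su2TorusIdentityFlow_meanAccept_mem_Icc`**
  `(8/9)·(2/β)^V (Σ_n I_{n+1}(2β)^V)²/Σ_n I_{n+1}(4β)^V ≤ acc ≤ (4/β)^V (Σ_n I_{n+1}(β)^V)²/Σ_n I_{n+1}(2β)^V`
  (the action-convention prefactors `e^{−2βV}` cancel; `(e^{−2β}/β)²/(e^{−4β}/(2β)) = 2/β`;
  `4β` is written `2·(2β)`);
* §2 U(1) (`β > 0`, `L ≥ 2`): **`u1HaarTorusIdentityFlow_essFrac`** `ESS = (Σₖ I_{|k|}(β)^V)²/Σₖ I_{|k|}(2β)^V`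
  and **`u1HaarTorusIdentityFlow_meanAccept_mem_Icc`** — the same closed forms as row 3's
  box-coordinate `u1TorusIdentityFlow_essFrac` / `…_meanAccept_mem_Icc` (`Scaling/U1WilsonIdentityFlowLaw`),
  now for theory-2's Haar-measure formalisation of the same model (an independent cross-check of the
  two coordinate systems; no equality between the two measures is asserted here).

Reading (value-free; no number of ours is computed or implied): the zero-training SU(2) row of the
S0-C / R1a boards on an `L × L` torus is an explicit ratio of Bessel sector sums, decaying geometrically
in `L²`, exactly like the U(1) row.  NOT CLAIMED: SU(3); `d = 4`; any value at the cell's `(β, L)`;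
asymptotics of the SU(2) sector sums; nothing re-scored, SEALED.md untouched.
-/

noncomputable section

namespace Summit.Ventures.LatticeQCDFlow.Theory2

open MeasureTheory Real
open Literature.Analysis.FunctionSpaces (besselI)
open Literature.MathematicalPhysics.QuantumFieldTheory
open Literature.MathematicalPhysics.QuantumLattice (fundamentalRep continuous_fundamentalRep u1Rep
  continuous_u1Rep)
open Summit.Ventures.LatticeQCDFlow.Scoring

variable {L : ℕ} [NeZero L] {β : ℝ}

/-! ## §1 SU(2) on `(ℤ/L)²` -/

section SU2

/-- The action-convention prefactors cancel: `((e^{−2β}/β)^V·A)² / ((e^{−4β}/(2β))^V·B) = (2/β)^V·A²/B`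
(stated for the coupling pair `(γ, 2γ)`). [folklore] -/
theorem su2_prefactor_cancel {γ : ℝ} (hγ : γ ≠ 0) (V : ℕ) (A B : ℝ) :
    ((Real.exp (-(2 * γ)) / γ) ^ V * A) ^ 2 / ((Real.exp (-(2 * (2 * γ))) / (2 * γ)) ^ V * B)
      = (2 / γ) ^ V * (A ^ 2 / B) := by
  have he : Real.exp (-(2 * (2 * γ))) = Real.exp (-(2 * γ)) ^ 2 := by
    rw [← Real.exp_nat_mul]; ring_nf
  have he0 : Real.exp (-(2 * γ)) ≠ 0 := (Real.exp_pos _).ne'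
  have key : (Real.exp (-(2 * γ)) / γ) ^ 2 / (Real.exp (-(2 * γ)) ^ 2 / (2 * γ)) = 2 / γ := by
    field_simp
  rw [he, mul_pow, ← pow_mul, mul_comm V 2, pow_mul, mul_div_mul_comm, ← div_pow, key]

/-- **`ESS^{SU(2)}_{L×L}(β) = (2/β)^{L²}·(Σ_n I_{n+1}(2β)^{L²})² / Σ_n I_{n+1}(4β)^{L²}`** — the
effective sample size of the untrained exact SU(2) sampler (fresh Haar links against the Wilson law)
on the two-dimensional torus, `β > 0`, every `L ≥ 1`. [ours] -/
theorem su2TorusIdentityFlow_essFrac (hβ : 0 < β) :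
    (∫ U, Real.exp (-β * wilsonAction (fundamentalRep (Fin 2)) U)
          / ∫ V, Real.exp (-β * wilsonAction (fundamentalRep (Fin 2)) V)
            ∂(Measure.pi fun _ : Edge 2 L => haarProbability (Matrix.specialUnitaryGroup (Fin 2) ℂ))
        ∂(Measure.pi fun _ : Edge 2 L => haarProbability (Matrix.specialUnitaryGroup (Fin 2) ℂ))) ^ 2
        / ∫ U, (Real.exp (-β * wilsonAction (fundamentalRep (Fin 2)) U)
          / ∫ V, Real.exp (-β * wilsonAction (fundamentalRep (Fin 2)) V)
            ∂(Measure.pi fun _ : Edge 2 L => haarProbability (Matrix.specialUnitaryGroup (Fin 2) ℂ))) ^ 2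
          ∂(Measure.pi fun _ : Edge 2 L => haarProbability (Matrix.specialUnitaryGroup (Fin 2) ℂ))
      = (2 / β) ^ (L ^ 2) * ((∑' n : ℕ, besselI (n + 1) (2 * β) ^ (L ^ 2)) ^ 2
          / ∑' n : ℕ, besselI (n + 1) (2 * (2 * β)) ^ (L ^ 2)) := by
  rw [wilsonIdentityFlow_essFrac_partitionFunction (fundamentalRep (Fin 2))
      (continuous_fundamentalRep (Fin 2)),
    partitionFunction_su2_two_toReal_eq_mul_tsum hβ,
    partitionFunction_su2_two_toReal_eq_mul_tsum (by linarith : 0 < 2 * β),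
    su2_prefactor_cancel hβ.ne']

/-- **THE UNTRAINED SU(2) ACCEPTANCE SANDWICH ON THE TORUS** (`β > 0`, `V = L²`):
`(8/9)·(2/β)^V (Σ_n I_{n+1}(2β)^V)²/Σ_n I_{n+1}(4β)^V ≤ acc ≤ (4/β)^V (Σ_n I_{n+1}(β)^V)²/Σ_n I_{n+1}(2β)^V`.
[ours] -/
theorem su2TorusIdentityFlow_meanAccept_mem_Icc (hβ : 0 < β) :
    ∫ U, ∫ U', min (Real.exp (-β * wilsonAction (fundamentalRep (Fin 2)) U)
          / ∫ V, Real.exp (-β * wilsonAction (fundamentalRep (Fin 2)) V)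
            ∂(Measure.pi fun _ : Edge 2 L => haarProbability (Matrix.specialUnitaryGroup (Fin 2) ℂ)))
        (Real.exp (-β * wilsonAction (fundamentalRep (Fin 2)) U')
          / ∫ V, Real.exp (-β * wilsonAction (fundamentalRep (Fin 2)) V)
            ∂(Measure.pi fun _ : Edge 2 L => haarProbability (Matrix.specialUnitaryGroup (Fin 2) ℂ)))
        ∂(Measure.pi fun _ : Edge 2 L => haarProbability (Matrix.specialUnitaryGroup (Fin 2) ℂ))
        ∂(Measure.pi fun _ : Edge 2 L => haarProbability (Matrix.specialUnitaryGroup (Fin 2) ℂ))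
      ∈ Set.Icc (8 / 9 * ((2 / β) ^ (L ^ 2) * ((∑' n : ℕ, besselI (n + 1) (2 * β) ^ (L ^ 2)) ^ 2
            / ∑' n : ℕ, besselI (n + 1) (2 * (2 * β)) ^ (L ^ 2))))
          ((4 / β) ^ (L ^ 2) * ((∑' n : ℕ, besselI (n + 1) β ^ (L ^ 2)) ^ 2
            / ∑' n : ℕ, besselI (n + 1) (2 * β) ^ (L ^ 2))) := by
  have h := wilsonIdentityFlow_meanAccept_mem_Icc_partitionFunction (d := 2) (L := L)
    (fundamentalRep (Fin 2)) (continuous_fundamentalRep (Fin 2)) β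
  rw [partitionFunction_su2_two_toReal_eq_mul_tsum hβ,
    partitionFunction_su2_two_toReal_eq_mul_tsum (by linarith : 0 < 2 * β),
    partitionFunction_su2_two_toReal_eq_mul_tsum (by linarith : 0 < β / 2),
    su2_prefactor_cancel hβ.ne'] at h
  have h2 := su2_prefactor_cancel (by linarith : β / 2 ≠ 0) (L ^ 2)
    (∑' n : ℕ, besselI (n + 1) (2 * (β / 2)) ^ (L ^ 2)) (∑' n : ℕ, besselI (n + 1) (2 * β) ^ (L ^ 2))
  rw [show (2 : ℝ) * (β / 2) = β by ring, show (2 : ℝ) / (β / 2) = 4 / β by ring] at h2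
  rw [show (2 : ℝ) * (β / 2) = β by ring, h2] at h
  exact h

end SU2

/-! ## §2 U(1) on `(ℤ/L)²` in theory-2's Haar-measure formalisation -/

section U1

/-- `Z^{U(1)}(γ).toReal = e^{−γV} Σₖ I_{|k|}(γ)^V` for `γ > 0`, `L ≥ 2`. [ours] -/
theorem u1_partitionFunction_two_toReal {γ : ℝ} (hγ : 0 < γ) (hL : 2 ≤ L) :
    (partitionFunction (d := 2) (L := L) u1Rep γ).toReal
      = Real.exp (-γ) ^ (L ^ 2) * ∑' n : ℤ, besselI n.natAbs γ ^ (L ^ 2) := by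
  rw [u1_partitionFunction_two_eq_besselI γ hL, ENNReal.toReal_ofReal]
  exact mul_nonneg (pow_nonneg (Real.exp_pos _).le _)
    (tsum_nonneg fun k => pow_nonneg (Literature.Analysis.FunctionSpaces.besselI_nonneg _ hγ.le) _)

/-- The action-convention prefactors cancel: `((e^{−γ})^V A)² / ((e^{−2γ})^V B) = A²/B`. [folklore] -/
theorem u1_prefactor_cancel (γ : ℝ) (V : ℕ) (A B : ℝ) :
    (Real.exp (-γ) ^ V * A) ^ 2 / (Real.exp (-(2 * γ)) ^ V * B) = A ^ 2 / B := by
  have he : Real.exp (-(2 * γ)) = Real.exp (-γ) ^ 2 := by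
    rw [← Real.exp_nat_mul]; ring_nf
  rw [he, mul_pow, ← pow_mul, ← pow_mul, mul_comm V 2,
    mul_div_mul_left _ _ (pow_ne_zero _ (Real.exp_pos _).ne')]

/-- **`ESS^{U(1)}_{L×L}(β) = (Σₖ I_{|k|}(β)^{L²})² / Σₖ I_{|k|}(2β)^{L²}`** for theory-2's Haar-measure
U(1) torus (`β > 0`, `L ≥ 2`) — the same closed form as the box-coordinate
`u1TorusIdentityFlow_essFrac`. [ours] -/
theorem u1HaarTorusIdentityFlow_essFrac (hβ : 0 < β) (hL : 2 ≤ L) :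
    (∫ U, Real.exp (-β * wilsonAction u1Rep U) / ∫ V, Real.exp (-β * wilsonAction u1Rep V)
            ∂(Measure.pi fun _ : Edge 2 L => haarProbability Circle)
        ∂(Measure.pi fun _ : Edge 2 L => haarProbability Circle)) ^ 2
        / ∫ U, (Real.exp (-β * wilsonAction u1Rep U) / ∫ V, Real.exp (-β * wilsonAction u1Rep V)
            ∂(Measure.pi fun _ : Edge 2 L => haarProbability Circle)) ^ 2
          ∂(Measure.pi fun _ : Edge 2 L => haarProbability Circle)
      = (∑' k : ℤ, besselI k.natAbs β ^ (L ^ 2)) ^ 2 / ∑' k : ℤ, besselI k.natAbs (2 * β) ^ (L ^ 2) := by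
  rw [wilsonIdentityFlow_essFrac_partitionFunction u1Rep continuous_u1Rep,
    u1_partitionFunction_two_toReal hβ hL, u1_partitionFunction_two_toReal (by linarith) hL,
    u1_prefactor_cancel]

/-- **THE UNTRAINED U(1) ACCEPTANCE SANDWICH ON THE HAAR-MEASURE TORUS** (`β > 0`, `L ≥ 2`):
`(8/9)·(Σₖ I_{|k|}(β)^V)²/Σₖ I_{|k|}(2β)^V ≤ acc ≤ (Σₖ I_{|k|}(β/2)^V)²/Σₖ I_{|k|}(β)^V`. [ours] -/
theorem u1HaarTorusIdentityFlow_meanAccept_mem_Icc (hβ : 0 < β) (hL : 2 ≤ L) :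
    ∫ U, ∫ U', min (Real.exp (-β * wilsonAction u1Rep U) / ∫ V, Real.exp (-β * wilsonAction u1Rep V)
            ∂(Measure.pi fun _ : Edge 2 L => haarProbability Circle))
        (Real.exp (-β * wilsonAction u1Rep U') / ∫ V, Real.exp (-β * wilsonAction u1Rep V)
            ∂(Measure.pi fun _ : Edge 2 L => haarProbability Circle))
        ∂(Measure.pi fun _ : Edge 2 L => haarProbability Circle)
        ∂(Measure.pi fun _ : Edge 2 L => haarProbability Circle)
      ∈ Set.Icc (8 / 9 * ((∑' k : ℤ, besselI k.natAbs β ^ (L ^ 2)) ^ 2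
            / ∑' k : ℤ, besselI k.natAbs (2 * β) ^ (L ^ 2)))
          ((∑' k : ℤ, besselI k.natAbs (β / 2) ^ (L ^ 2)) ^ 2
            / ∑' k : ℤ, besselI k.natAbs β ^ (L ^ 2)) := by
  have h := wilsonIdentityFlow_meanAccept_mem_Icc_partitionFunction (d := 2) (L := L)
    u1Rep continuous_u1Rep β
  rw [u1_partitionFunction_two_toReal hβ hL, u1_partitionFunction_two_toReal (by linarith) hL,
    u1_partitionFunction_two_toReal (by linarith : 0 < β / 2) hL, u1_prefactor_cancel] at h
  have h2 := u1_prefactor_cancel (β / 2) (L ^ 2) (∑' k : ℤ, besselI k.natAbs (β / 2) ^ (L ^ 2))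
    (∑' k : ℤ, besselI k.natAbs β ^ (L ^ 2))
  rw [show (2 : ℝ) * (β / 2) = β by ring] at h2
  rw [h2] at h
  exact h

end U1

end Summit.Ventures.LatticeQCDFlow.Theory2

end
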